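/-
Copyright (c) 2026 the pub-hodgecm-mathlib formalisation cell (harness21).  Prover seat hodgecm-mathlib-K2Liu-p03 (g8), Track B «K2-LIT»,
#184♮ = hLiu418 = `stmt-HodgeConjecture-24832`; socket #41, KIND 1 — (K1a-T)(L2-dock) THE GAUSSIAN DECAY LETTER `hAcb` OF THE ARCH CONTINUATION IN THE `D`-CURRENCY,
ASSEMBLED FROM THE PER-PLACE ARCH ALPHABET (★ p863921 D-1 shapes) AND THREE DICTIONARY LETTERS (K1a desk K2Liu-p01 (g11) WORD #2 (3), 2026-09-05T02:08:16Z;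
census 02:10:23Z: the decay is JOINT in `p(x_S)·|σc S|_w`, so the Gaussian dictionary is ONE letter on `Σ_w` of the exponents; `D`-currency 02:11:05Z).
THEOREMS ONLY (no `def`, no `instance`, no notation, no named-fact hypothesis, no `sorry`).
-/
import Summits.HodgeConjecture.HodgeConjecture.Theorems.K2LiuIncoherentRankOneArchSplitOfFaces   -- ★ `ac_eq_cA_mul_prod_of_archLetters` (D-1 alphabet; identity theorem inside)
import Literature.NumberTheory.Automorphic.AdelicHeightGLProofs                                  -- ★ `adelicHeightGL_nonneg`
import Summits.HodgeConjecture.HodgeConjecture.Theorems.K2LiuKindWArchGrowthKUniform           -- ★ p864125 (K2E4-p10): `re_pos_of_dist_lt_half`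
import HarnessLib

/-!
# Crux `HLiu418`, socket #41, KIND 1 a♮ — (K1a-T)(L2-dock) `K2LiuKindOneSingularArchDecayOfRecord`: `‖Ac‖ ≤ C·‖h‖^a·e^{−b‖h‖^{−a'}τa}·(1+τa)^{N₁}·D^{Nd₁}`
# FROM THE PER-PLACE ARCH LETTERS, A PER-PLACE GROWTH LETTER AND THE GAUSSIAN ∕ PREFACTOR ∕ FRAME-CONSTANT DICTIONARIES

Cell `hodgecm-mathlib`, crux item hLiu418 = `stmt-HodgeConjecture-24832` (helper lane `--supports … --as helper`, count-neutral), route of record `HCCMUnconditional`;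
squad K2 ∕ K2Liu, road `K2_Liu`, socket #41, KIND 1, block K1-a♮.  CONSUMER: K2E4-p10 (g10)'s `hdec_of_factorBounds_den` (L2) slot `hAcb` in the `D`-currency (this seat's
«≠» 02:11:05Z), at the K1-a♮ assembly of record ★ p864122 ∕ (α) ED. 3 (K2Liu-p01 (g11)).

THE LETTER (generic rank `n`, faces `I X h ⊆ φ`).  INPUTS BY VALUE: (i) the D-1 per-place arch alphabet of ★ p863921 ∕ ★ `ac_eq_cA_mul_prod_of_archLetters` VERBATIM —
`I A Ac hAc hA Tinf Aloc Acw hAcw hAw cA hAinf` (so `Ac X i s h = cA X h i · ∏_{w∈Tinf} Acw X i w s h` on `{0 < re}`); (ii) the archimedean size `τa hτa`; (iii) the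
FRAME-CONSTANT dictionary `hcA : ‖cA X h i‖ ≤ C₀·‖h‖^{a₀}·(1+τa X)^{N₀}·d^{Nd₀}`; (iv) the PER-PLACE GROWTH letter of the continued local arch block, near every `z ∈ {0 < re}`:
`‖Acw X i w s h‖ ≤ Cg·Pw X h w^{M}·exp(−cg·gw X h w)` (`Pw ≥ 1` a polynomial size, `gw` the Gaussian exponent — ARCH-CONT lineage, C131-p02; scalar type = a bound on ★ p864004's
explicit formula); (v) the PREFACTOR dictionary `∏_{w∈Tinf} Pw X h w ≤ C₁·‖h‖^{a₁}·(1+τa X)^{N₁}·d^{Nd₁}` (height hands; `D`-currency because single places carry no lattice lower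
bound); (vi) the JOINT GAUSSIAN dictionary `b₀·‖h‖^{−a₀'}·τa X ≤ Σ_{w∈Tinf} gw X h w` (Levi-translate Gaussian parameter `p_w((Λγ̂·h)_∞)·|σc X|_w ≍ ⟨V_w(h_∞), ι_w X⟩`, `λ_min(V_w(h_∞)) ≥
c·‖h‖^{−2}`, rank-one `T_L`-skew structure).  OUTPUT = the (L2) letter in the `D`-currency:
`∀ z, 0 < re z → ∃ N₁ Nd₁ C a b a' r, … ∀ X s, dist s z < r → ∀ h, rank-one → ∀ d ≥ 1, d·X integral → ∀ i ∈ I X h,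
 ‖Ac X i s h‖ ≤ C·‖h‖^a·(exp(−(b·‖h‖^{−a'}·τa X))·(1+τa X)^{N₁})·d^{Nd₁}`.
* **`hAcb_of_archLetters`** — the letter.
HONEST LABEL.  Count-neutral helper (an assembler: the analysis is in the named letters (iii)–(vi)); it closes no socket: `HC_CM` is proved only modulo the 7 printed
citations (2 remaining named inputs: hLiu418 = `stmt-HodgeConjecture-24832`, h413 = `stmt-HodgeConjecture-24833`) until rung 0 closes.

## References
* [KudlaRallis1994] S. Kudla, S. Rallis, *A regularized Siegel–Weil formula: the first term identity*, Ann. of Math. 140 (1994): §2 (2.10)–(2.12).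
* [Shimura1982] G. Shimura, *Confluent hypergeometric functions on tube domains*, Math. Ann. 260 (1982): §4 Thm. 4.2.
* [Shimura1997] G. Shimura, *Euler Products and Eisenstein Series*, CBMS 93 (1997): §18.4 Prop. 18.14.
* [MoeglinWaldspurger1995] C. Mœglin, J.-L. Waldspurger, *Spectral Decomposition and Eisenstein Series* (1995): I.2.2, II.1.7, IV.1.9.
-/

set_option autoImplicit false
-- the mandated namespace repeats the single-problem summit's segment (`HodgeConjecture.HodgeConjecture`)
set_option linter.dupNamespace false

noncomputable section

open scoped Matrix
open NumberField NumberField.InfinitePlace IsDedekindDomain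

namespace Summit.HodgeConjecture.HodgeConjecture.Cruxes.HLiu418.K2LiuKindOneSingularArchDecayOfRecord

open Literature.NumberTheory.Automorphic Literature.NumberTheory.Automorphic.UnitaryGroup Literature.NumberTheory.GaloisRepresentations
open Literature.NumberTheory.GelbartRogawski1991 Literature.NumberTheory.GelbartRogawski1991.GRConstruction
open Literature.NumberTheory.GelbartRogawski1991.UnitaryDualPair
open Literature.NumberTheory.K2Lit.SiegelDoubled
open Summit.HodgeConjecture.HodgeConjecture.Cruxes.HLiu418.K2LiuSiegelUnipotentFourierDefs
open Summit.HodgeConjecture.HodgeConjecture.Cruxes.HLiu418.K2LiuIncoherentRankOneArchSplitOfFaces (ac_eq_cA_mul_prod_of_archLetters)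
open Summit.HodgeConjecture.HodgeConjecture.Cruxes.HLiu418.K2LiuKindWArchGrowthKUniform (re_pos_of_dist_lt_half)

variable (L : Type) [Field L] [NumberField L] [IsCMField L]

section Decay

variable {N M n : ℕ} (e : Fin N × Fin M ≃ Fin n)
  (dV : Fin N → L) (hdV : ∀ i, IsCMField.complexConj L (dV i) = dV i)
  (dW : Fin M → L) (hdW : ∀ i, IsCMField.complexConj L (dW i) = dW i)

open Classical in -- the archimedean size `‖(ι_∞ X_ab)_ab‖` is read with the consumers' instances (★ p863404 ∕ ★ p864122: `open Classical in`)
/-- **(K1a-T)(L2-dock) THE GAUSSIAN DECAY LETTER OF THE ARCH CONTINUATION, IN THE `D`-CURRENCY, FROM THE PER-PLACE LETTERS.**  INPUTS (all by value): the D-1 alphabet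
`I A Ac hAc hA Tinf Aloc Acw hAcw hAw cA hAinf` of ★ `ac_eq_cA_mul_prod_of_archLetters` VERBATIM; `τa hτa`; the frame-constant dictionary `hcA`; the per-place growth letter
`hAcwb` (polynomial size `Pw ≥ 1` — `hP1` —, Gaussian exponent `gw`); the prefactor dictionary `hP`; the joint Gaussian dictionary `hgauss`.  OUTPUT: the (L2) letter
`∀ z, 0 < re z → ∃ N₁ Nd₁ C a b a' r, … ‖Ac X i s h‖ ≤ C·‖h‖^a·(exp(−(b·‖h‖^{−a'}·τa X))·(1+τa X)^{N₁})·d^{Nd₁}` (constants: `b = cg·b₀`, `a' = a₀'`, `a = a₀ + a₁·M`, `N₁ = N₀ + N₁'·M`,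
`Nd₁ = Nd₀ + Nd₁'·M`, `C = C₀·Cg^{#Tinf}·C₁^{M}`, `r = min r_g (re z ∕ 2)`).
[cite: KudlaRallis1994, §2 (2.10)–(2.12)] [cite: Shimura1982, §4 Thm. 4.2] [cite: Shimura1997, §18.4 Prop. 18.14] [cite: MoeglinWaldspurger1995, I.2.2, IV.1.9] -/
theorem hAcb_of_archLetters {φ : Type*}
    (I : skewMatrices ((IsCMField.complexConj L : L ≃ₐ[Fp L] L) : L →+* L) ((gramR L e dV hdV dW hdW).map (algebraMap (Fp L) L)) → HA L e dV hdV dW hdW → Finset φ)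
    -- ★ p863404 §2 (ii)'s per-face arch letters `A Ac hAc hA` VERBATIM (`S ↦ X`)
    (A : skewMatrices ((IsCMField.complexConj L : L ≃ₐ[Fp L] L) : L →+* L) ((gramR L e dV hdV dW hdW).map (algebraMap (Fp L) L)) → φ → ℂ → HA L e dV hdV dW hdW → ℂ)
    (Ac : skewMatrices ((IsCMField.complexConj L : L ≃ₐ[Fp L] L) : L →+* L) ((gramR L e dV hdV dW hdW).map (algebraMap (Fp L) L)) → φ → ℂ → HA L e dV hdV dW hdW → ℂ)
    (hAc : ∀ X : skewMatrices ((IsCMField.complexConj L : L ≃ₐ[Fp L] L) : L →+* L) ((gramR L e dV hdV dW hdW).map (algebraMap (Fp L) L)),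
      (X : Matrix (Fin n) (Fin n) L) ≠ 0 → (X : Matrix (Fin n) (Fin n) L).det = 0 → ∀ (h : HA L e dV hdV dW hdW), ∀ i ∈ I X h,
        DifferentiableOn ℂ (fun s => Ac X i s h) {s : ℂ | 0 < s.re})
    (hA : ∀ X : skewMatrices ((IsCMField.complexConj L : L ≃ₐ[Fp L] L) : L →+* L) ((gramR L e dV hdV dW hdW).map (algebraMap (Fp L) L)),
      (X : Matrix (Fin n) (Fin n) L) ≠ 0 → (X : Matrix (Fin n) (Fin n) L).det = 0 → ∀ (h : HA L e dV hdV dW hdW), ∀ i ∈ I X h, ∀ s : ℂ, 1 < s.re → A X i s h = Ac X i s h)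
    -- the per-place arch letters (★ p863717's `(A Ac hA hAc)` shape at the `w`-component, lifted to the adelic point and the face)
    (Tinf : Finset (InfinitePlace L))
    (Aloc : skewMatrices ((IsCMField.complexConj L : L ≃ₐ[Fp L] L) : L →+* L) ((gramR L e dV hdV dW hdW).map (algebraMap (Fp L) L)) → φ → InfinitePlace L → ℂ →
      HA L e dV hdV dW hdW → ℂ)
    (Acw : skewMatrices ((IsCMField.complexConj L : L ≃ₐ[Fp L] L) : L →+* L) ((gramR L e dV hdV dW hdW).map (algebraMap (Fp L) L)) → φ → InfinitePlace L → ℂ →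
      HA L e dV hdV dW hdW → ℂ)
    (hAcw : ∀ X : skewMatrices ((IsCMField.complexConj L : L ≃ₐ[Fp L] L) : L →+* L) ((gramR L e dV hdV dW hdW).map (algebraMap (Fp L) L)),
      (X : Matrix (Fin n) (Fin n) L) ≠ 0 → (X : Matrix (Fin n) (Fin n) L).det = 0 → ∀ (h : HA L e dV hdV dW hdW), ∀ i ∈ I X h, ∀ w ∈ Tinf,
        DifferentiableOn ℂ (fun s => Acw X i w s h) {s : ℂ | 0 < s.re})
    (hAw : ∀ X : skewMatrices ((IsCMField.complexConj L : L ≃ₐ[Fp L] L) : L →+* L) ((gramR L e dV hdV dW hdW).map (algebraMap (Fp L) L)),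
      (X : Matrix (Fin n) (Fin n) L) ≠ 0 → (X : Matrix (Fin n) (Fin n) L).det = 0 → ∀ (h : HA L e dV hdV dW hdW), ∀ i ∈ I X h, ∀ w ∈ Tinf,
        ∀ s : ℂ, 1 / 2 < s.re → Aloc X i w s h = Acw X i w s h)
    -- the place-tensor letter on the convergence half-plane, with its scalar `cA`
    (cA : skewMatrices ((IsCMField.complexConj L : L ≃ₐ[Fp L] L) : L →+* L) ((gramR L e dV hdV dW hdW).map (algebraMap (Fp L) L)) → HA L e dV hdV dW hdW → φ → ℂ)
    (hAinf : ∀ X : skewMatrices ((IsCMField.complexConj L : L ≃ₐ[Fp L] L) : L →+* L) ((gramR L e dV hdV dW hdW).map (algebraMap (Fp L) L)),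
      (X : Matrix (Fin n) (Fin n) L) ≠ 0 → (X : Matrix (Fin n) (Fin n) L).det = 0 → ∀ (h : HA L e dV hdV dW hdW), ∀ i ∈ I X h,
        ∀ s : ℂ, 1 < s.re → A X i s h = cA X h i * ∏ w ∈ Tinf, Aloc X i w s h)
    -- the archimedean size (★ p863404's `τa hτa`)
    (τa : skewMatrices ((IsCMField.complexConj L : L ≃ₐ[Fp L] L) : L →+* L) ((gramR L e dV hdV dW hdW).map (algebraMap (Fp L) L)) → ℝ)
    (hτa : ∀ X : skewMatrices ((IsCMField.complexConj L : L ≃ₐ[Fp L] L) : L →+* L) ((gramR L e dV hdV dW hdW).map (algebraMap (Fp L) L)),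
      ‖(fun i j => NumberField.mixedEmbedding L ((X : Matrix (Fin n) (Fin n) L) i j))‖ ≤ τa X)
    -- (iii) the FRAME-CONSTANT dictionary ((D-arch-Fub) lineage): `‖cA X h i‖ ≤ C₀·‖h‖^{a₀}·(1+τa X)^{N₀}·d^{Nd₀}`
    {C₀ a₀ : ℝ} (N₀ Nd₀ : ℕ) (hC₀ : 0 ≤ C₀) (ha₀ : 0 ≤ a₀)
    (hcA : ∀ (X : skewMatrices ((IsCMField.complexConj L : L ≃ₐ[Fp L] L) : L →+* L) ((gramR L e dV hdV dW hdW).map (algebraMap (Fp L) L))) (h : HA L e dV hdV dW hdW),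
      (X : Matrix (Fin n) (Fin n) L) ≠ 0 → (X : Matrix (Fin n) (Fin n) L).det = 0 → ∀ d : ℕ, 1 ≤ d → (∀ i j, IsIntegral ℤ ((d : L) * (X : Matrix (Fin n) (Fin n) L) i j)) →
      ∀ i ∈ I X h, ‖cA X h i‖ ≤ C₀ * adelicHeightGL (n + n) L (h : GL (Fin (n + n)) (AdeleRing (𝓞 L) L)) ^ a₀ * (1 + τa X) ^ N₀ * (d : ℝ) ^ Nd₀)
    -- (iv) the PER-PLACE GROWTH letter of the continued local arch block (ARCH-CONT lineage): polynomial size `Pw ≥ 1`, Gaussian exponent `gw`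
    (Pw gw : skewMatrices ((IsCMField.complexConj L : L ≃ₐ[Fp L] L) : L →+* L) ((gramR L e dV hdV dW hdW).map (algebraMap (Fp L) L)) → HA L e dV hdV dW hdW →
      InfinitePlace L → ℝ)
    (hP1 : ∀ (X : skewMatrices ((IsCMField.complexConj L : L ≃ₐ[Fp L] L) : L →+* L) ((gramR L e dV hdV dW hdW).map (algebraMap (Fp L) L))) (h : HA L e dV hdV dW hdW),
      (X : Matrix (Fin n) (Fin n) L) ≠ 0 → (X : Matrix (Fin n) (Fin n) L).det = 0 → ∀ w ∈ Tinf, 1 ≤ Pw X h w)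
    (hAcwb : ∀ z : ℂ, 0 < z.re → ∃ (Mg : ℕ) (Cg cg rg : ℝ), 0 ≤ Cg ∧ 0 < cg ∧ 0 < rg ∧
      ∀ (X : skewMatrices ((IsCMField.complexConj L : L ≃ₐ[Fp L] L) : L →+* L) ((gramR L e dV hdV dW hdW).map (algebraMap (Fp L) L))) (s : ℂ), dist s z < rg →
      ∀ h : HA L e dV hdV dW hdW, (X : Matrix (Fin n) (Fin n) L) ≠ 0 → (X : Matrix (Fin n) (Fin n) L).det = 0 → ∀ i ∈ I X h, ∀ w ∈ Tinf,
        ‖Acw X i w s h‖ ≤ Cg * Pw X h w ^ Mg * Real.exp (-(cg * gw X h w)))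
    -- (v) the PREFACTOR dictionary (height hands; `D`-currency): `∏_{w∈Tinf} Pw X h w ≤ C₁·‖h‖^{a₁}·(1+τa X)^{N₁'}·d^{Nd₁'}`
    {C₁ a₁ : ℝ} (N₁' Nd₁' : ℕ) (hC₁ : 0 ≤ C₁) (ha₁ : 0 ≤ a₁)
    (hP : ∀ (X : skewMatrices ((IsCMField.complexConj L : L ≃ₐ[Fp L] L) : L →+* L) ((gramR L e dV hdV dW hdW).map (algebraMap (Fp L) L))) (h : HA L e dV hdV dW hdW),
      (X : Matrix (Fin n) (Fin n) L) ≠ 0 → (X : Matrix (Fin n) (Fin n) L).det = 0 → ∀ d : ℕ, 1 ≤ d → (∀ i j, IsIntegral ℤ ((d : L) * (X : Matrix (Fin n) (Fin n) L) i j)) →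
      ∏ w ∈ Tinf, Pw X h w ≤ C₁ * adelicHeightGL (n + n) L (h : GL (Fin (n + n)) (AdeleRing (𝓞 L) L)) ^ a₁ * (1 + τa X) ^ N₁' * (d : ℝ) ^ Nd₁')
    -- (vi) the JOINT GAUSSIAN dictionary: `b₀·‖h‖^{−a₀'}·τa X ≤ Σ_{w∈Tinf} gw X h w`
    {b₀ a₀' : ℝ} (hb₀ : 0 < b₀) (ha₀' : 0 ≤ a₀')
    (hgauss : ∀ (X : skewMatrices ((IsCMField.complexConj L : L ≃ₐ[Fp L] L) : L →+* L) ((gramR L e dV hdV dW hdW).map (algebraMap (Fp L) L))) (h : HA L e dV hdV dW hdW),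
      (X : Matrix (Fin n) (Fin n) L) ≠ 0 → (X : Matrix (Fin n) (Fin n) L).det = 0 →
      b₀ * adelicHeightGL (n + n) L (h : GL (Fin (n + n)) (AdeleRing (𝓞 L) L)) ^ (-a₀') * τa X ≤ ∑ w ∈ Tinf, gw X h w) :
    ∀ z : ℂ, 0 < z.re → ∃ (N₁ Nd₁ : ℕ) (C a b a' r : ℝ), 0 ≤ C ∧ 0 ≤ a ∧ 0 < b ∧ 0 ≤ a' ∧ 0 < r ∧
      ∀ (X : skewMatrices ((IsCMField.complexConj L : L ≃ₐ[Fp L] L) : L →+* L) ((gramR L e dV hdV dW hdW).map (algebraMap (Fp L) L))) (s : ℂ), dist s z < r →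
      ∀ h : HA L e dV hdV dW hdW, (X : Matrix (Fin n) (Fin n) L) ≠ 0 → (X : Matrix (Fin n) (Fin n) L).det = 0 →
      ∀ d : ℕ, 1 ≤ d → (∀ i j, IsIntegral ℤ ((d : L) * (X : Matrix (Fin n) (Fin n) L) i j)) → ∀ i ∈ I X h,
        ‖Ac X i s h‖ ≤ C * adelicHeightGL (n + n) L (h : GL (Fin (n + n)) (AdeleRing (𝓞 L) L)) ^ a *
          (Real.exp (-(b * adelicHeightGL (n + n) L (h : GL (Fin (n + n)) (AdeleRing (𝓞 L) L)) ^ (-a') * τa X)) * (1 + τa X) ^ N₁) * (d : ℝ) ^ Nd₁ := by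
  intro z hz
  obtain ⟨Mg, Cg, cg, rg, hCg, hcg, hrg, hgrowth⟩ := hAcwb z hz
  refine ⟨N₀ + N₁' * Mg, Nd₀ + Nd₁' * Mg, C₀ * Cg ^ Tinf.card * C₁ ^ Mg, a₀ + a₁ * Mg, cg * b₀, a₀', min rg (z.re / 2),
    by positivity, by positivity, mul_pos hcg hb₀, ha₀', lt_min hrg (by linarith), fun X s hs h hX0 hdet d hd hdX i hi => ?_⟩
  have hsg : dist s z < rg := hs.trans_le (min_le_left _ _)
  have hs0 : 0 < s.re := re_pos_of_dist_lt_half hz (hs.trans_le (min_le_right _ _))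
  -- abbreviations
  set H : ℝ := adelicHeightGL (n + n) L (h : GL (Fin (n + n)) (AdeleRing (𝓞 L) L)) with hHdef
  have hH0 : 0 ≤ H := adelicHeightGL_nonneg _
  have hτ0 : 0 ≤ τa X := (norm_nonneg _).trans (hτa X)
  have hd0 : (0 : ℝ) ≤ d := Nat.cast_nonneg d
  -- the continued block is the place tensor of the continued local letters on `{0 < re}` (★ identity theorem inside)
  have hsplit : Ac X i s h = cA X h i * ∏ w ∈ Tinf, Acw X i w s h :=
    ac_eq_cA_mul_prod_of_archLetters L e dV hdV dW hdW I A Ac hAc hA Tinf Aloc Acw hAcw hAw cA hAinf X hX0 hdet h i hi s hs0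
  -- the per-place bounds multiplied up
  have hprod : ∏ w ∈ Tinf, ‖Acw X i w s h‖ ≤ ∏ w ∈ Tinf, (Cg * Pw X h w ^ Mg * Real.exp (-(cg * gw X h w))) :=
    Finset.prod_le_prod (fun w _ => norm_nonneg _) fun w hw => hgrowth X s hsg h hX0 hdet i hi w hw
  have hreorg : ∏ w ∈ Tinf, (Cg * Pw X h w ^ Mg * Real.exp (-(cg * gw X h w))) =
      Cg ^ Tinf.card * (∏ w ∈ Tinf, Pw X h w) ^ Mg * Real.exp (-(cg * ∑ w ∈ Tinf, gw X h w)) := by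
    rw [Finset.prod_mul_distrib, Finset.prod_mul_distrib, Finset.prod_const, Finset.prod_pow, ← Real.exp_sum, Finset.mul_sum, ← Finset.sum_neg_distrib]
  -- the three dictionaries
  have hPpos : 0 ≤ ∏ w ∈ Tinf, Pw X h w := Finset.prod_nonneg fun w hw => zero_le_one.trans (hP1 X h hX0 hdet w hw)
  have hPM : (∏ w ∈ Tinf, Pw X h w) ^ Mg ≤ (C₁ * H ^ a₁ * (1 + τa X) ^ N₁' * (d : ℝ) ^ Nd₁') ^ Mg :=
    pow_le_pow_left₀ hPpos (hP X h hX0 hdet d hd hdX) Mg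
  have hexp : Real.exp (-(cg * ∑ w ∈ Tinf, gw X h w)) ≤ Real.exp (-(cg * b₀ * H ^ (-a₀') * τa X)) := by
    rw [Real.exp_le_exp]
    have := mul_le_mul_of_nonneg_left (hgauss X h hX0 hdet) hcg.le
    nlinarith
  have hcAi := hcA X h hX0 hdet d hd hdX i hi
  -- ASSEMBLY
  rw [hsplit, norm_mul, norm_prod]
  calc ‖cA X h i‖ * ∏ w ∈ Tinf, ‖Acw X i w s h‖
      ≤ (C₀ * H ^ a₀ * (1 + τa X) ^ N₀ * (d : ℝ) ^ Nd₀) * (Cg ^ Tinf.card * (∏ w ∈ Tinf, Pw X h w) ^ Mg * Real.exp (-(cg * ∑ w ∈ Tinf, gw X h w))) := by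
        rw [← hreorg]
        exact mul_le_mul hcAi hprod (Finset.prod_nonneg fun w _ => norm_nonneg _) (by positivity)
    _ ≤ (C₀ * H ^ a₀ * (1 + τa X) ^ N₀ * (d : ℝ) ^ Nd₀) *
          (Cg ^ Tinf.card * (C₁ * H ^ a₁ * (1 + τa X) ^ N₁' * (d : ℝ) ^ Nd₁') ^ Mg * Real.exp (-(cg * b₀ * H ^ (-a₀') * τa X))) := by
        refine mul_le_mul_of_nonneg_left ?_ (by positivity)
        exact mul_le_mul (mul_le_mul_of_nonneg_left hPM (by positivity)) hexp (Real.exp_nonneg _) (by positivity)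
    _ = C₀ * Cg ^ Tinf.card * C₁ ^ Mg * H ^ (a₀ + a₁ * Mg) *
          (Real.exp (-(cg * b₀ * H ^ (-a₀') * τa X)) * (1 + τa X) ^ (N₀ + N₁' * Mg)) * (d : ℝ) ^ (Nd₀ + Nd₁' * Mg) := by
        rw [Real.rpow_add_of_nonneg hH0 ha₀ (by positivity), Real.rpow_mul_natCast hH0 a₁ Mg]
        simp only [mul_pow, pow_add, pow_mul]
        ring

end Decay

end Summit.HodgeConjecture.HodgeConjecture.Cruxes.HLiu418.K2LiuKindOneSingularArchDecayOfRecord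

end
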